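import Summits.QuantumFields.YangMills.Theorems.BalabanUVNodesN11InnerPrivateCoordinateChartSocket
import Summits.QuantumFields.YangMills.Theorems.BalabanUVNodesN11PerBondInverseLawsOfRecordAC
import Summits.QuantumFields.YangMills.Theorems.BalabanUVNodesN11TStepOfRecordSeparated

/-!
# DAG node N11 — THE INNER FIBRE CHART OF THE SEPARATED TRANSPORT IN PRIVATE COORDINATES: dag-n11-d's `(κ, Ψ, J, S; hpush, hfib)` of the bond-partition presentation
# INHABITED by resampling ONLY the central bonds of the coarse bonds OFF `sV′`, the outside fine field kept for 11a's un-charted `kernelRTOfRecord`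

HEADER — WORK-UNIT METADATA.  Cell `pub-ymgap`, YM-PLAN Track A (HUMAN RULING D-0062 ∕ D-0149 ∕ D-0154 (3a)), WIDTH SEAT `pub-ymgap-dag-n11-w6` (g2) on node N11 [B14];
route `BalabanUVNodes`, key item K1⁷ `StabilityBAtRecordR13SepCoPH` = stmt-QuantumFields-20542 (helper lane, `--kind proof --supports 20542 --as helper`, count-neutral).
[I] = [Balaban1987RG1], [III] = [Balaban1988Convergent].  Bus: CLAIM-3 = INTENT-3 of this seat (R455 (A)), DECL-DELTA-3 (split 3a ∕ 3b ∕ 3c by the 400-line rule).  File 3c of this seat's private-coordinate road (3a generic engine with a kept parameter; 3b the inner socket `hpush` ∕ `hfib` at the presentation) (file 1 p620673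
`…N11TransportOfRecordInPrivateCoordinateChart`: the FULL-lattice chart for dag-n11-d's per-density socket; file 2 p622229 `…N11PerBondInverseLawsOfRecordAC`: the inverse laws from
absolute continuity by kernel Radon–Nikodym).  Over dag-n11-d g14's `…N11TStepOfRecordSeparated` (p616225: def-T's (†) read through the bond-partition presentation `(sV, sV′)` of a
saturated region IS 11a's `kernelRTOfRecord` applied to the INNER READING of the graph integrand — GIVEN an inner fibre chart `(X, κ, Ψ, J, S; hpush, hfib)` of the presented
carriers), dag-n11-e g21's `Node00/AveragingSkewPresentation` (p612977: the glue `e_sV = piEquivPiSubtypeProd`, `centralBond_mem_bondsIn_iff`, measurability of the rest factor)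
dag-n09-w6 g3's `T4TriangularFibredChart` (p616307) through this seat's file 3a `…N11PrivateCoordinateChartKeptParameter` (the chart with a KEPT outside parameter).

WHY THIS FILE.  Files 1–2 chart the FULL averaging: every central bond `β(c)` is resampled, the outside ones too — honest, but NOT what the (O3′) ∕ BranchSum chain reads
(p616225 → p617211 → p619836 ∕ p620817: `hin` ∕ `hinnerSum` are INNER readings of the SEPARATED transport, [III] (2.21)'s «`∫dV|_{Ω^c} δ(V̄V′⁻¹) … ∫dA|_{Ω} …`»: the outside fine
field `y = U|_{sV}` is transported by 11a's un-charted `kernelRTOfRecord`, only the inside is charted).  THIS FILE puts the private-coordinate chart exactly there: for a fine region `Y`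
saturated at level `k+1` with bond sets `sV ↔ bondsIn k Y`, `sV′ ↔ bondsIn (k+1) Y`, the coarse bonds OFF `sV′` have their central bonds OFF `sV` (`centralBond_mem_bondsIn_iff`), the
rest factor `r ↦ (Ū(e_sV⁻¹(y, r)) c)_{c ∉ sV′}` is LOCAL in those private coordinates for every outside field `y` (`isLocal_avgFun` through the glue), and dag-n09-w6's engine —
run PER OUTSIDE FIELD `y` and integrated over `y` (file 3a) — yields the inner chart with `X :=` the off-`sV` fine configurations, CONSTANT fibre reference `κ := Kernel.const _ (⊗_{b ∉ sV} Haar)`,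
`Ψ ((y, v₂), r) := extend β′ (c ↦ ϑ_c(e_sV⁻¹(y,r), v₂ c)) r` (`β′ c = centralBond c` as an off-`sV` bond), `J := 𝟙[∀ c ∉ sV′, v₂ c ∈ T_c]·∏_{c ∉ sV′} j_c`, charted set
`S := {(y, r) | ∀ c ∉ sV′, r(β′ c) ∈ Ω_c(e_sV⁻¹(y,r))}` — from the SAME full-lattice per-bond inversion data `(Ω, T, ϑ, j)` as files 1–2, USED ONLY AT `c ∉ sV′`.  So p616225's
★★★★ gives def-T's (†) through `e_{sV′}` as «11a's `kernelRTOfRecord` of the resampled `dr`-integral of the (†)-integrand», `dV′`-a.e., with the support clause `hwS` on the step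
weights seeing ONLY the inside private coordinates (where the small-field restrictions (3.2)–(3.5) act).

WHAT THIS FILE PROVES (0 `def`, 0 `sorry`, standard axioms; over file 3a `…N11PrivateCoordinateChartKeptParameter` (generic engine with a kept outside parameter) and file 3b
`…N11InnerPrivateCoordinateChartSocket` (`hpush_innerPrivateChart` ∕ `hfib_innerPrivateChart` ∕ measurability at the presentation)).
★★★ `transportOfRecord_comp_glue_ae_eq_kernelRTOfRecord_privateInnerChart` (dag-n11-w2's p614048 BY NAME on file 3b's socket, EVERY `dU`-integrable density with the support
clause on the inside private coordinates) · ★★★ `tstepOfRecord_comp_glue_ae_eq_kernelRTOfRecord_privateInnerChart` (p616225 ★★★★ BY NAME on file 3b's socket: def-T's (†) through `e_{sV′}` `=ᵐ (V_out, v₂) ↦ kernelRTOfRecord … sV sV′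
[y ↦ ∫ dr 𝟙·∏ j · G_{s′}(e_sV⁻¹(y, extend β′ (ϑ_c(e_sV⁻¹(y,r), v₂ c))_c r))] V_out`, support clause on the INSIDE private coordinates only) · ★★ `exists_jacobian_hpush_innerPrivateChart` (file 2: the law
drops out — per-bond INVERSES alone give `∃ jd` with `hpush` ∧ `hfib`).

HONEST FRAMING.  Helper lane of K1⁷; count-neutral; kernel measure theory BY NAME; per-bond windows ∕ inverses `(Ω, T, ϑ; hΩm hΩbl hTm hθm hright [hleft, hΩT])` and (§3 main) the
density `j` with `hlaw` are HYPOTHESES (dag-n09-w6's in-flight files; file 2); the saturation `hY` and the bond sets `hsV`∕`hsV′` are displayed as in p616225; the step weights'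
measurability ∕ integrability ∕ support clause are displayed; NO chart of Bałaban's ((47), [III] (3.10)–(3.25)) is asserted — a valid inner chart of the disintegration, not print's;
(B4) ∕ (S-α) ∕ (O3′) NOT closed; N11 NOT discharged; K1⁷ ∕ K1⁸ NOT closed, no registered stub touched; counts unmoved (typed 28∕28 · discharged 5∕27 · A 5∕28).  No summit statement is
proved by this seat.  One finite `𝕋⁴_{L^K}` programme at fixed `ε = L^{−K}`; R4 closes only the conditional finite-𝕋⁴ rung `BalabanLadder.UV` — NOT ℝ⁴, NOT OS, NOT a mass gap, NOT Clay.
No `sorry`, `axiom`, `def`, `instance`, `notation`.  The binder `[DecidableEq (PBond (F.P K) (k + 1))]` of §2 is bookkeeping: it pins the `Fintype {c // c ∉ sV′}` instance to the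
consumer's local one (p616225's), avoiding a definitional mismatch with the tree's global `instDecidableEqPBond` (cf. `B15Prop1IntrinsicAtCoPRecord` header).
Sources (SHAPE ∕ bookkeeping only): [I] (0.4) p.253, (2.4) p.266, (2.10) p.267; [III] (2.21) p.258, (3.1) p.264, (3.2)–(3.5) p.265, p.267 L18–24, (3.24)–(3.25) p.270.
-/

noncomputable section

open MeasureTheory ProbabilityTheory Set Function
open scoped ENNReal NNReal

namespace Summit.QuantumFields.YangMills.Theorems.BalabanUVNodesN11InnerTransportInPrivateCoordinateChart

open Literature.MathematicalPhysics.QuantumFieldTheory.Balaban1983to89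
open Literature.MathematicalPhysics.QuantumFieldTheory.Balaban1983to89.T4AveragingDisintegration
open Literature.MathematicalPhysics.QuantumFieldTheory.Balaban1983to89.BlockAveragingHaarAC (centralBond centralBond_injective isLocal_avgFun)
open Summit.QuantumFields.YangMills.Theorems.BalabanUVNodesN11TransportOfRecordInPrivateCoordinateChart (succ_le_m_add_K)
open Summit.QuantumFields.YangMills.Theorems.BalabanUVNodesN11PerBondInverseLawsOfRecordAC (exists_perBondInverseLaws_of_inverses)
open Summit.QuantumFields.YangMills.Theorems.BalabanUVNodesN11InnerPrivateCoordinateChartSocket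
open Summit.QuantumFields.YangMills.Theorems.BalabanUVNodesN11TStepOfRecordSeparated (tstepOfRecord_comp_glue_ae_eq_kernelRTOfRecord_of_innerChart)
open Summit.QuantumFields.YangMills.Theorems.BalabanUVNodesN11TransportOfRecordSeparated (transportOfRecord_comp_glue_ae_eq_kernelRTOfRecord_of_innerChart)

section Record

open Node00 hiding SU
open T4Continuum
open B10Eq42TorusConstraint (bondsIn)
open B10Eq38TorusDomains (toFine)

variable {F : T4Family} {N : ℕ} [NeZero N] {K k : ℕ}
  (Ω T : PBond (F.P K) (k + 1) → GaugeField (F.P K) k (SU N) → Set (SU N))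
  (ϑ : PBond (F.P K) (k + 1) → GaugeField (F.P K) k (SU N) → SU N → SU N)
  (jd : PBond (F.P K) (k + 1) → GaugeField (F.P K) k (SU N) → SU N → ℝ≥0)


/-- **★★★ THE SEPARATED TRANSPORT OF RECORD WITH THE INNER STEP IN THE PRIVATE-COORDINATE CHART, EVERY DENSITY** (dag-n11-w2's p614048
`transportOfRecord_comp_glue_ae_eq_kernelRTOfRecord_of_innerChart` BY NAME on file 3b's socket): at step `k < K`, for a fine region `Y` saturated at level `k+1` with bond sets
`sV ↔ bondsIn k Y`, `sV′ ↔ bondsIn (k+1) Y`, FULL-lattice per-bond inversion data used at `c ∉ sV′`, and ANY `dU`-integrable measurable density `ρ` whose support meets the SUPPORT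
CLAUSE «`ρ U ≠ 0 ⇒` every private coordinate `U(β c)`, `c ∉ sV′`, lies in its window `Ω_c(U)`» (the place where the old front factor `χ_k(init s′)` ∕ the (3.2)–(3.5) restrictions act):
`(transportOfRecord F N K k ρ) ∘ e_{sV′}⁻¹ =ᵐ (V_out, v₂) ↦ kernelRTOfRecord F N K k sV sV′ [y ↦ ∫ dr 𝟙·∏ j · ρ(e_sV⁻¹(y, extend β′ (ϑ_c(e_sV⁻¹(y,r), v₂ c))_c r))] V_out` — outside by 11a's
UN-CHARTED restricted transport, inside at the RESAMPLED point. [cite: Balaban1988Convergent, (2.21) p.258, (3.1) p.264, p.267 L18–24; Balaban1987RG1, (0.4) p.253, (2.10) p.267] -/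
theorem transportOfRecord_comp_glue_ae_eq_kernelRTOfRecord_privateInnerChart [DecidableEq (PBond (F.P K) k)] [DecidableEq (PBond (F.P K) (k + 1))]
    (hkK : k < K)
    {Y : Set (Site (F.P K) 0)} (hY : ∀ s : Site (F.P K) k, toFine k s ∈ Y ↔ toFine (k + 1) (blockOf s) ∈ Y)
    {sV : Finset (PBond (F.P K) k)} (hsV : ∀ b : PBond (F.P K) k, b ∈ sV ↔ b ∈ bondsIn k Y)
    {sV' : Finset (PBond (F.P K) (k + 1))} (hsV' : ∀ c : PBond (F.P K) (k + 1), c ∈ sV' ↔ c ∈ bondsIn (k + 1) Y)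
    (hΩm : ∀ c, MeasurableSet {q : GaugeField (F.P K) k (SU N) × SU N | q.2 ∈ Ω c q.1})
    (hTm : ∀ c, MeasurableSet {q : GaugeField (F.P K) k (SU N) × SU N | q.2 ∈ T c q.1})
    (hθm : ∀ c, Measurable fun q : GaugeField (F.P K) k (SU N) × SU N => ϑ c q.1 q.2)
    (hjm : ∀ c, Measurable fun q : GaugeField (F.P K) k (SU N) × SU N => jd c q.1 q.2)
    (hΩbl : ∀ c (U : GaugeField (F.P K) k (SU N)) (g' : PBond (F.P K) (k + 1) → SU N), Ω c (extend centralBond g' U) = Ω c U)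
    (hright : ∀ c U, ∀ v ∈ T c U, (avOfRecord F N K k).avg (update U (centralBond c) (ϑ c U v)) c = v)
    (hlaw : ∀ c U, (HaarData.haar : Measure (SU N)).restrict (Ω c U) =
      (((HaarData.haar : Measure (SU N)).restrict (T c U)).withDensity fun v => (jd c U v : ℝ≥0∞)).map (ϑ c U))
    {ρ : Density (F.P K) k (SU N)} (hρm : Measurable ρ) (hρ : Integrable ρ (fieldMeasure (F.P K) k (SU N)))
    (hρS : ∀ U, ρ U ≠ 0 → ∀ c, c ∉ sV' → U (centralBond c) ∈ Ω c U)
    (hβ' : ∀ c : PBond (F.P K) (k + 1), c ∉ sV' → centralBond c ∉ sV) :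
    (transportOfRecord F N K k ρ) ∘ ⇑(MeasurableEquiv.piEquivPiSubtypeProd (fun _ : PBond (F.P K) (k + 1) => SU N) (· ∈ sV')).symm
      =ᵐ[(Measure.pi fun _ : ↥sV' => (HaarData.haar : Measure (SU N))).prod
          (Measure.pi fun _ : {c : PBond (F.P K) (k + 1) // c ∉ sV'} => (HaarData.haar : Measure (SU N)))]
        fun v => kernelRTOfRecord F N K k sV sV'
          (fun y => ∫ r,
            (({z : ((↥sV → SU N) × ({c : PBond (F.P K) (k + 1) // c ∉ sV'} → SU N)) × ({b : PBond (F.P K) k // b ∉ sV} → SU N) |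
                ∀ c : {c : PBond (F.P K) (k + 1) // c ∉ sV'},
                  z.1.2 c ∈ T c ((MeasurableEquiv.piEquivPiSubtypeProd (fun _ : PBond (F.P K) k => SU N) (· ∈ sV)).symm (z.1.1, z.2))}.indicator
              (fun z => ∏ c : {c : PBond (F.P K) (k + 1) // c ∉ sV'},
                jd c ((MeasurableEquiv.piEquivPiSubtypeProd (fun _ : PBond (F.P K) k => SU N) (· ∈ sV)).symm (z.1.1, z.2)) (z.1.2 c)) ((y, v.2), r) : ℝ≥0) : ℝ) *
            ρ ((MeasurableEquiv.piEquivPiSubtypeProd (fun _ : PBond (F.P K) k => SU N) (· ∈ sV)).symm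
                (y, extend (fun c : {c : PBond (F.P K) (k + 1) // c ∉ sV'} =>
                    (⟨centralBond (c : PBond (F.P K) (k + 1)), hβ' c c.2⟩ : {b : PBond (F.P K) k // b ∉ sV}))
                  (fun c : {c : PBond (F.P K) (k + 1) // c ∉ sV'} =>
                    ϑ c ((MeasurableEquiv.piEquivPiSubtypeProd (fun _ : PBond (F.P K) k => SU N) (· ∈ sV)).symm (y, r)) (v.2 c)) r))
            ∂(Measure.pi fun _ : {b : PBond (F.P K) k // b ∉ sV} => (HaarData.haar : Measure (SU N))))
          v.1 := by
  have hk : k + 1 ≤ (F.P K).m + (F.P K).K := succ_le_m_add_K hkK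
  have hρS' : ∀ q : (↥sV → SU N) × ({b : PBond (F.P K) k // b ∉ sV} → SU N),
      q ∉ {q : (↥sV → SU N) × ({b : PBond (F.P K) k // b ∉ sV} → SU N) | ∀ c : {c : PBond (F.P K) (k + 1) // c ∉ sV'},
        q.2 ⟨centralBond (c : PBond (F.P K) (k + 1)), hβ' c c.2⟩ ∈
          Ω c ((MeasurableEquiv.piEquivPiSubtypeProd (fun _ : PBond (F.P K) k => SU N) (· ∈ sV)).symm q)} →
      ρ ((MeasurableEquiv.piEquivPiSubtypeProd (fun _ : PBond (F.P K) k => SU N) (· ∈ sV)).symm q) = 0 := by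
    intro q hq
    by_contra hne
    refine hq fun c => ?_
    have h := hρS _ hne c c.2
    rwa [glue_symm_apply, dif_neg (hβ' c c.2)] at h
  have h := transportOfRecord_comp_glue_ae_eq_kernelRTOfRecord_of_innerChart F N K k hkK hk hY hsV hsV'
    (κ := Kernel.const _ (Measure.pi fun _ : {b : PBond (F.P K) k // b ∉ sV} => (HaarData.haar : Measure (SU N))))
    (Ψ := fun z : ((↥sV → SU N) × ({c : PBond (F.P K) (k + 1) // c ∉ sV'} → SU N)) × ({b : PBond (F.P K) k // b ∉ sV} → SU N) =>
      extend (fun c : {c : PBond (F.P K) (k + 1) // c ∉ sV'} =>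
          (⟨centralBond (c : PBond (F.P K) (k + 1)), hβ' c c.2⟩ : {b : PBond (F.P K) k // b ∉ sV}))
        (fun c : {c : PBond (F.P K) (k + 1) // c ∉ sV'} =>
          ϑ c ((MeasurableEquiv.piEquivPiSubtypeProd (fun _ : PBond (F.P K) k => SU N) (· ∈ sV)).symm (z.1.1, z.2)) (z.1.2 c)) z.2)
    (J := fun z : ((↥sV → SU N) × ({c : PBond (F.P K) (k + 1) // c ∉ sV'} → SU N)) × ({b : PBond (F.P K) k // b ∉ sV} → SU N) =>
      {z : ((↥sV → SU N) × ({c : PBond (F.P K) (k + 1) // c ∉ sV'} → SU N)) × ({b : PBond (F.P K) k // b ∉ sV} → SU N) |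
          ∀ c : {c : PBond (F.P K) (k + 1) // c ∉ sV'},
            z.1.2 c ∈ T c ((MeasurableEquiv.piEquivPiSubtypeProd (fun _ : PBond (F.P K) k => SU N) (· ∈ sV)).symm (z.1.1, z.2))}.indicator
        (fun z => ∏ c : {c : PBond (F.P K) (k + 1) // c ∉ sV'},
          jd c ((MeasurableEquiv.piEquivPiSubtypeProd (fun _ : PBond (F.P K) k => SU N) (· ∈ sV)).symm (z.1.1, z.2)) (z.1.2 c)) z)
    (S := {q : (↥sV → SU N) × ({b : PBond (F.P K) k // b ∉ sV} → SU N) | ∀ c : {c : PBond (F.P K) (k + 1) // c ∉ sV'},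
      q.2 ⟨centralBond (c : PBond (F.P K) (k + 1)), hβ' c c.2⟩ ∈
        Ω c ((MeasurableEquiv.piEquivPiSubtypeProd (fun _ : PBond (F.P K) k => SU N) (· ∈ sV)).symm q)})
    (measurable_innerPrivateChart ϑ hk hβ' hθm) (measurable_innerPrivateJacobian T jd hTm hjm)
    (hpush_innerPrivateChart Ω T ϑ jd hkK hβ' hΩm hTm hθm hjm hΩbl hright hlaw) (hfib_innerPrivateChart T ϑ jd hkK hβ' hTm hjm hright _)
    hρm hρ hρS'
  simpa only [Kernel.const_apply] using h

/-- **★★★ def-T's VALUE-LEVEL T-STEP (†) THROUGH THE COARSE PRESENTATION, WITH THE INNER STEP IN THE PRIVATE-COORDINATE CHART** (dag-n11-d's p616225 ★★★★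
`tstepOfRecord_comp_glue_ae_eq_kernelRTOfRecord_of_innerChart` BY NAME on `hpush_innerPrivateChart` ∕ `hfib_innerPrivateChart`): at step `k < K` of the run `p`, for a fine region `Y`
saturated at level `k+1` with bond sets `sV ↔ bondsIn k Y`, `sV′ ↔ bondsIn (k+1) Y`, FULL-lattice per-bond inversion data `(Ω, T, ϑ, j; hΩbl, hright, hlaw)` (used at `c ∉ sV′` only), a slot
family `Tk`, a new sequence `s′`, the graph integrand `G_{s′}(U) = w(s′)(U, Ū)·χ_k(init s′)(U)·Tk(init s′)(U)` measurable and `dU`-integrable, and the SUPPORT CLAUSE on the step weights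
«`w(s′)(U, Ū) ≠ 0 ⇒` every private coordinate `U(β c)`, `c ∉ sV′`, lies in its window `Ω_c(U)`» ((3.2)–(3.5) act INSIDE), and `hβ′`
(`centralBond_not_mem_of_not_mem`: the central bonds of the coarse bonds off `sV′` are off `sV`):
`(tstepOfRecord … k Tk s′) ∘ e_{sV′}⁻¹ =ᵐ[(⊗_{sV′} dW) ⊗ (⊗_{c ∉ sV′} dW)] (V_out, v₂) ↦ kernelRTOfRecord F N p.K k sV sV′ [y ↦ ∫ dr 𝟙·∏ j · G_{s′}(e_sV⁻¹(y, extend β′ (ϑ_c(e_sV⁻¹(y,r), v₂ c))_c r))] V_out`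
— outside variables by 11a's UN-CHARTED restricted transport of record, inside variables read at the RESAMPLED point, `dV′`-a.e.  [III] (2.21)∕(3.1) with the δ-functions of the
inside step removed by solving `Ū′(c) = v₂(c)`, `c ∉ sV′`, for the inside central bonds. [cite: Balaban1988Convergent, (2.21) p.258, (3.1) p.264, (3.2)–(3.5) p.265, (3.23)–(3.25) p.270; Balaban1987RG1, (0.4) p.253, (2.10) p.267] -/
theorem tstepOfRecord_comp_glue_ae_eq_kernelRTOfRecord_privateInnerChart (ν : Stage7Numerics) (M : ℕ) (w : StepWeightsOfRecord F N ν M) (p : B12.RunParams)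
    (g : ℕ → ℝ) {k : ℕ} (hkK : k < p.K) [DecidableEq (PBond (F.P p.K) k)] [DecidableEq (PBond (F.P p.K) (k + 1))]
    (Tk : SeqOfRecord F ν M g p.K k → Density (F.P p.K) k (SU N)) (s' : SeqOfRecord F ν M g p.K (k + 1))
    {Y : Set (Site (F.P p.K) 0)} (hY : ∀ s : Site (F.P p.K) k, toFine k s ∈ Y ↔ toFine (k + 1) (blockOf s) ∈ Y)
    {sV : Finset (PBond (F.P p.K) k)} (hsV : ∀ b : PBond (F.P p.K) k, b ∈ sV ↔ b ∈ bondsIn k Y)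
    {sV' : Finset (PBond (F.P p.K) (k + 1))} (hsV' : ∀ c : PBond (F.P p.K) (k + 1), c ∈ sV' ↔ c ∈ bondsIn (k + 1) Y)
    (Ω T : PBond (F.P p.K) (k + 1) → GaugeField (F.P p.K) k (SU N) → Set (SU N))
    (ϑ : PBond (F.P p.K) (k + 1) → GaugeField (F.P p.K) k (SU N) → SU N → SU N)
    (jd : PBond (F.P p.K) (k + 1) → GaugeField (F.P p.K) k (SU N) → SU N → ℝ≥0)
    (hΩm : ∀ c, MeasurableSet {q : GaugeField (F.P p.K) k (SU N) × SU N | q.2 ∈ Ω c q.1})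
    (hTm : ∀ c, MeasurableSet {q : GaugeField (F.P p.K) k (SU N) × SU N | q.2 ∈ T c q.1})
    (hθm : ∀ c, Measurable fun q : GaugeField (F.P p.K) k (SU N) × SU N => ϑ c q.1 q.2)
    (hjm : ∀ c, Measurable fun q : GaugeField (F.P p.K) k (SU N) × SU N => jd c q.1 q.2)
    (hΩbl : ∀ c (U : GaugeField (F.P p.K) k (SU N)) (g' : PBond (F.P p.K) (k + 1) → SU N), Ω c (extend centralBond g' U) = Ω c U)
    (hright : ∀ c U, ∀ v ∈ T c U, (avOfRecord F N p.K k).avg (update U (centralBond c) (ϑ c U v)) c = v)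
    (hlaw : ∀ c U, (HaarData.haar : Measure (SU N)).restrict (Ω c U) =
      (((HaarData.haar : Measure (SU N)).restrict (T c U)).withDensity fun v => (jd c U v : ℝ≥0∞)).map (ϑ c U))
    (hw : Measurable fun U => w p g k s' U ((avOfRecord F N p.K k).avg U)) (hχ : Measurable (chiSeqOfRecord F N ν M g p.K k s'.init))
    (hT : Measurable (Tk s'.init))
    (hG : Integrable (fun U => w p g k s' U ((avOfRecord F N p.K k).avg U) * (chiSeqOfRecord F N ν M g p.K k s'.init U * Tk s'.init U))
      (fieldMeasure (F.P p.K) k (SU N)))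
    (hwS : ∀ U, w p g k s' U ((avOfRecord F N p.K k).avg U) ≠ 0 → ∀ c, c ∉ sV' → U (centralBond c) ∈ Ω c U)
    (hβ' : ∀ c : PBond (F.P p.K) (k + 1), c ∉ sV' → centralBond c ∉ sV) :
    (tstepOfRecord F N ν M w p g k Tk s') ∘ ⇑(MeasurableEquiv.piEquivPiSubtypeProd (fun _ : PBond (F.P p.K) (k + 1) => SU N) (· ∈ sV')).symm
      =ᵐ[(Measure.pi fun _ : ↥sV' => (HaarData.haar : Measure (SU N))).prod
          (Measure.pi fun _ : {c : PBond (F.P p.K) (k + 1) // c ∉ sV'} => (HaarData.haar : Measure (SU N)))]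
        fun v => kernelRTOfRecord F N p.K k sV sV'
          (fun y => ∫ r,
            (({z : ((↥sV → SU N) × ({c : PBond (F.P p.K) (k + 1) // c ∉ sV'} → SU N)) × ({b : PBond (F.P p.K) k // b ∉ sV} → SU N) |
                ∀ c : {c : PBond (F.P p.K) (k + 1) // c ∉ sV'},
                  z.1.2 c ∈ T c ((MeasurableEquiv.piEquivPiSubtypeProd (fun _ : PBond (F.P p.K) k => SU N) (· ∈ sV)).symm (z.1.1, z.2))}.indicator
              (fun z => ∏ c : {c : PBond (F.P p.K) (k + 1) // c ∉ sV'},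
                jd c ((MeasurableEquiv.piEquivPiSubtypeProd (fun _ : PBond (F.P p.K) k => SU N) (· ∈ sV)).symm (z.1.1, z.2)) (z.1.2 c)) ((y, v.2), r) : ℝ≥0) : ℝ) *
            (fun U => w p g k s' U ((avOfRecord F N p.K k).avg U) * (chiSeqOfRecord F N ν M g p.K k s'.init U * Tk s'.init U))
              ((MeasurableEquiv.piEquivPiSubtypeProd (fun _ : PBond (F.P p.K) k => SU N) (· ∈ sV)).symm
                (y, extend (fun c : {c : PBond (F.P p.K) (k + 1) // c ∉ sV'} =>
                    (⟨centralBond (c : PBond (F.P p.K) (k + 1)), hβ' c c.2⟩ : {b : PBond (F.P p.K) k // b ∉ sV}))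
                  (fun c : {c : PBond (F.P p.K) (k + 1) // c ∉ sV'} =>
                    ϑ c ((MeasurableEquiv.piEquivPiSubtypeProd (fun _ : PBond (F.P p.K) k => SU N) (· ∈ sV)).symm (y, r)) (v.2 c)) r))
            ∂(Measure.pi fun _ : {b : PBond (F.P p.K) k // b ∉ sV} => (HaarData.haar : Measure (SU N))))
          v.1 := by
  have hk : k + 1 ≤ (F.P p.K).m + (F.P p.K).K := succ_le_m_add_K hkK
  -- the support clause: off the charted set some inside private coordinate has left its window
  have hwS' : ∀ q : (↥sV → SU N) × ({b : PBond (F.P p.K) k // b ∉ sV} → SU N),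
      q ∉ {q : (↥sV → SU N) × ({b : PBond (F.P p.K) k // b ∉ sV} → SU N) | ∀ c : {c : PBond (F.P p.K) (k + 1) // c ∉ sV'},
        q.2 ⟨centralBond (c : PBond (F.P p.K) (k + 1)), hβ' c c.2⟩ ∈
          Ω c ((MeasurableEquiv.piEquivPiSubtypeProd (fun _ : PBond (F.P p.K) k => SU N) (· ∈ sV)).symm q)} →
      w p g k s' ((MeasurableEquiv.piEquivPiSubtypeProd (fun _ : PBond (F.P p.K) k => SU N) (· ∈ sV)).symm q)
        ((avOfRecord F N p.K k).avg ((MeasurableEquiv.piEquivPiSubtypeProd (fun _ : PBond (F.P p.K) k => SU N) (· ∈ sV)).symm q)) = 0 := by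
    intro q hq
    by_contra hne
    refine hq fun c => ?_
    have h := hwS _ hne c c.2
    rwa [glue_symm_apply, dif_neg (hβ' c c.2)] at h
  have h := tstepOfRecord_comp_glue_ae_eq_kernelRTOfRecord_of_innerChart ν M w p g hkK hk Tk s' hY hsV hsV'
    (κ := Kernel.const _ (Measure.pi fun _ : {b : PBond (F.P p.K) k // b ∉ sV} => (HaarData.haar : Measure (SU N))))
    (Ψ := fun z : ((↥sV → SU N) × ({c : PBond (F.P p.K) (k + 1) // c ∉ sV'} → SU N)) × ({b : PBond (F.P p.K) k // b ∉ sV} → SU N) =>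
      extend (fun c : {c : PBond (F.P p.K) (k + 1) // c ∉ sV'} =>
          (⟨centralBond (c : PBond (F.P p.K) (k + 1)), hβ' c c.2⟩ : {b : PBond (F.P p.K) k // b ∉ sV}))
        (fun c : {c : PBond (F.P p.K) (k + 1) // c ∉ sV'} =>
          ϑ c ((MeasurableEquiv.piEquivPiSubtypeProd (fun _ : PBond (F.P p.K) k => SU N) (· ∈ sV)).symm (z.1.1, z.2)) (z.1.2 c)) z.2)
    (J := fun z : ((↥sV → SU N) × ({c : PBond (F.P p.K) (k + 1) // c ∉ sV'} → SU N)) × ({b : PBond (F.P p.K) k // b ∉ sV} → SU N) =>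
      {z : ((↥sV → SU N) × ({c : PBond (F.P p.K) (k + 1) // c ∉ sV'} → SU N)) × ({b : PBond (F.P p.K) k // b ∉ sV} → SU N) |
          ∀ c : {c : PBond (F.P p.K) (k + 1) // c ∉ sV'},
            z.1.2 c ∈ T c ((MeasurableEquiv.piEquivPiSubtypeProd (fun _ : PBond (F.P p.K) k => SU N) (· ∈ sV)).symm (z.1.1, z.2))}.indicator
        (fun z => ∏ c : {c : PBond (F.P p.K) (k + 1) // c ∉ sV'},
          jd c ((MeasurableEquiv.piEquivPiSubtypeProd (fun _ : PBond (F.P p.K) k => SU N) (· ∈ sV)).symm (z.1.1, z.2)) (z.1.2 c)) z)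
    (S := {q : (↥sV → SU N) × ({b : PBond (F.P p.K) k // b ∉ sV} → SU N) | ∀ c : {c : PBond (F.P p.K) (k + 1) // c ∉ sV'},
      q.2 ⟨centralBond (c : PBond (F.P p.K) (k + 1)), hβ' c c.2⟩ ∈
        Ω c ((MeasurableEquiv.piEquivPiSubtypeProd (fun _ : PBond (F.P p.K) k => SU N) (· ∈ sV)).symm q)})
    (measurable_innerPrivateChart ϑ hk hβ' hθm) (measurable_innerPrivateJacobian T jd hTm hjm)
    (hpush_innerPrivateChart Ω T ϑ jd hkK hβ' hΩm hTm hθm hjm hΩbl hright hlaw) (hfib_innerPrivateChart T ϑ jd hkK hβ' hTm hjm hright _)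
    hw hχ hT hG hwS'
  simpa only [Kernel.const_apply] using h

/-- **★★ THE INNER SOCKET FROM PER-BOND INVERSES ALONE** (file 2 `exists_perBondInverseLaws_of_inverses`: the law drops out): at step `k < K`, for bond sets with `c ∉ sV′ → β(c) ∉ sV` and
FULL-lattice per-bond windows ∕ inverses `(Ω, T, ϑ; hΩm hTm hθm hΩbl hΩT hright hleft)` — NO law, NO Jacobian among the hypotheses — THERE IS a jointly measurable `jd ≥ 0` with p616225's
`hpush` ∧ `hfib` for the inner private-coordinate chart. [cite: Balaban1988Convergent, (2.21) p.258, (3.1) p.264, p.267 L18–24; Balaban1987RG1, (0.4) p.253, (2.10) p.267] -/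
theorem exists_jacobian_hpush_innerPrivateChart [DecidableEq (PBond (F.P K) k)] [DecidableEq (PBond (F.P K) (k + 1))] (hkK : k < K)
    {sV : Finset (PBond (F.P K) k)} {sV' : Finset (PBond (F.P K) (k + 1))}
    (hβ' : ∀ c : PBond (F.P K) (k + 1), c ∉ sV' → centralBond c ∉ sV)
    (hΩm : ∀ c, MeasurableSet {p : GaugeField (F.P K) k (SU N) × SU N | p.2 ∈ Ω c p.1})
    (hTm : ∀ c, MeasurableSet {p : GaugeField (F.P K) k (SU N) × SU N | p.2 ∈ T c p.1})
    (hθm : ∀ c, Measurable fun p : GaugeField (F.P K) k (SU N) × SU N => ϑ c p.1 p.2)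
    (hΩbl : ∀ c (U : GaugeField (F.P K) k (SU N)) (g : PBond (F.P K) (k + 1) → SU N), Ω c (extend centralBond g U) = Ω c U)
    (hΩT : ∀ c U, MapsTo (fun g => (avOfRecord F N K k).avg (update U (centralBond c) g) c) (Ω c U) (T c U))
    (hright : ∀ c U, ∀ v ∈ T c U, (avOfRecord F N K k).avg (update U (centralBond c) (ϑ c U v)) c = v)
    (hleft : ∀ c U, ∀ g ∈ Ω c U, ϑ c U ((avOfRecord F N K k).avg (update U (centralBond c) g) c) = g) :
    ∃ jd : PBond (F.P K) (k + 1) → GaugeField (F.P K) k (SU N) → SU N → ℝ≥0,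
      (∀ c, Measurable fun p : GaugeField (F.P K) k (SU N) × SU N => jd c p.1 p.2) ∧
      (((((Measure.pi fun _ : ↥sV => (HaarData.haar : Measure (SU N))).prod
            (Measure.pi fun _ : {c : PBond (F.P K) (k + 1) // c ∉ sV'} => (HaarData.haar : Measure (SU N)))) ⊗ₘ
            Kernel.const _ (Measure.pi fun _ : {b : PBond (F.P K) k // b ∉ sV} => (HaarData.haar : Measure (SU N)))).withDensity fun z =>
            (({z : ((↥sV → SU N) × ({c : PBond (F.P K) (k + 1) // c ∉ sV'} → SU N)) × ({b : PBond (F.P K) k // b ∉ sV} → SU N) |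
                ∀ c : {c : PBond (F.P K) (k + 1) // c ∉ sV'},
                  z.1.2 c ∈ T c ((MeasurableEquiv.piEquivPiSubtypeProd (fun _ : PBond (F.P K) k => SU N) (· ∈ sV)).symm (z.1.1, z.2))}.indicator
              (fun z => ∏ c : {c : PBond (F.P K) (k + 1) // c ∉ sV'},
                jd c ((MeasurableEquiv.piEquivPiSubtypeProd (fun _ : PBond (F.P K) k => SU N) (· ∈ sV)).symm (z.1.1, z.2)) (z.1.2 c)) z : ℝ≥0) : ℝ≥0∞)).map
          (fun z => (z.1.1, extend (fun c : {c : PBond (F.P K) (k + 1) // c ∉ sV'} =>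
              (⟨centralBond (c : PBond (F.P K) (k + 1)), hβ' c c.2⟩ : {b : PBond (F.P K) k // b ∉ sV}))
            (fun c : {c : PBond (F.P K) (k + 1) // c ∉ sV'} =>
              ϑ c ((MeasurableEquiv.piEquivPiSubtypeProd (fun _ : PBond (F.P K) k => SU N) (· ∈ sV)).symm (z.1.1, z.2)) (z.1.2 c)) z.2)) =
        ((Measure.pi fun _ : ↥sV => (HaarData.haar : Measure (SU N))).prod
            (Measure.pi fun _ : {b : PBond (F.P K) k // b ∉ sV} => (HaarData.haar : Measure (SU N)))).restrict
          {q | ∀ c : {c : PBond (F.P K) (k + 1) // c ∉ sV'},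
            q.2 ⟨centralBond (c : PBond (F.P K) (k + 1)), hβ' c c.2⟩ ∈
              Ω c ((MeasurableEquiv.piEquivPiSubtypeProd (fun _ : PBond (F.P K) k => SU N) (· ∈ sV)).symm q)}) ∧
      (∀ m : Measure (((↥sV → SU N) × ({c : PBond (F.P K) (k + 1) // c ∉ sV'} → SU N)) × ({b : PBond (F.P K) k // b ∉ sV} → SU N)),
        ∀ᵐ z ∂(m.withDensity fun z =>
            (({z : ((↥sV → SU N) × ({c : PBond (F.P K) (k + 1) // c ∉ sV'} → SU N)) × ({b : PBond (F.P K) k // b ∉ sV} → SU N) |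
                ∀ c : {c : PBond (F.P K) (k + 1) // c ∉ sV'},
                  z.1.2 c ∈ T c ((MeasurableEquiv.piEquivPiSubtypeProd (fun _ : PBond (F.P K) k => SU N) (· ∈ sV)).symm (z.1.1, z.2))}.indicator
              (fun z => ∏ c : {c : PBond (F.P K) (k + 1) // c ∉ sV'},
                jd c ((MeasurableEquiv.piEquivPiSubtypeProd (fun _ : PBond (F.P K) k => SU N) (· ∈ sV)).symm (z.1.1, z.2)) (z.1.2 c)) z : ℝ≥0) : ℝ≥0∞)),
          (fun c : {c : PBond (F.P K) (k + 1) // c ∉ sV'} =>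
            (avOfRecord F N K k).avg ((MeasurableEquiv.piEquivPiSubtypeProd (fun _ : PBond (F.P K) k => SU N) (· ∈ sV)).symm
              (z.1.1, extend (fun c : {c : PBond (F.P K) (k + 1) // c ∉ sV'} =>
                  (⟨centralBond (c : PBond (F.P K) (k + 1)), hβ' c c.2⟩ : {b : PBond (F.P K) k // b ∉ sV}))
                (fun c : {c : PBond (F.P K) (k + 1) // c ∉ sV'} =>
                  ϑ c ((MeasurableEquiv.piEquivPiSubtypeProd (fun _ : PBond (F.P K) k => SU N) (· ∈ sV)).symm (z.1.1, z.2)) (z.1.2 c)) z.2)) c) =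
            z.1.2) := by
  obtain ⟨jd, hjm, hlaw⟩ := exists_perBondInverseLaws_of_inverses hkK Ω T ϑ hΩm hTm hθm hΩT hleft
  exact ⟨jd, hjm, hpush_innerPrivateChart Ω T ϑ jd hkK hβ' hΩm hTm hθm hjm hΩbl hright hlaw,
    fun m => hfib_innerPrivateChart T ϑ jd hkK hβ' hTm hjm hright m⟩

end Record

end Summit.QuantumFields.YangMills.Theorems.BalabanUVNodesN11InnerTransportInPrivateCoordinateChart

end
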